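import Mathlib
import HarnessLib
import Summits.ResolutionOfSingularities.ResolutionOfSingularities.Theorems.WildQuotientsWildQuotientResolutionS1aExtendRees

/-!
# S1a — KILLABILITY AND GOODNESS TRANSPORT ALONG AN EQUIVARIANT ISOMORPHISM OF STABLE OPENS (both directions across the idle region of a move)

[OURS · L1 W4.5c · lead-1 g8; plan-1 STRATEGY-DESIGN v3.4 §(A0) «the (A0) transport lemma», ASSIGNMENT v10.12 (iv)] — NOT statements of the manuscript;
counted 0; AI-level work, weaker than expert review. Crux stmt-ResolutionOfSingularities-17941, line `s1a-logminvertex` v6.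

Two models `M₁`, `M₂` of one datum, `G`-stable opens `W₁ ⊆ M₁.V`, `W₂ ⊆ M₂.V` and an equivariant ISOMORPHISM `φ : ↑W₂ ⟶ ↑W₁` over `X₁`:
* `isIso_morphismRestrict_of_le`, `restrict_comm_of_comm` (bookkeeping);
* ★ `killableAt_transfer` — a kill chart of `M₁` through `W₁.ι (φ x)` (point in the support) gives one of `M₂` through `W₂.ι x`
  (`isPrincipalCentreChart_preimage'` along `W₁.ι` and `φ`, then `ExtendRees.isPrincipalCentreChart_image` along `W₂.ι`);
* ★ `isGoodAt_transfer` — goodness transports the same way;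
* for a MOVE `π' : M' → M` blowing up `𝒦.ideal d` with `G`-stable support complement `W`: ★ `killableAt_base_of_killableAt` (DOWN: `v'` killable through a
  chart meeting the support at `v'` ⇒ `π' v'` killable), `isGoodAt_base_of_isGoodAt` (DOWN), ★ `exists_isInducing_nonKillable_inter` (the non-killable
  points of `M` OFF the support embed into `nonKillable M'`) and ★ `topologicalKrullDim_nonKillable_diff_support_le_jInf` :
  `dim (nonKillable M ∖ supp 𝒦_d) ≤ jInf M'` — the formal half of (A0): a move can lower `jInf` only through its support.
-/

set_option linter.dupNamespace false

noncomputable section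

universe u

open CategoryTheory Limits AlgebraicGeometry TopologicalSpace Topology
open Literature.AlgebraicGeometry.Resolution Literature.AlgebraicGeometry.RelativeSpec
open Summit.ResolutionOfSingularities.ResolutionOfSingularities.Theorems.WildQuotientResolution.S1
open Summit.ResolutionOfSingularities.ResolutionOfSingularities.Theorems.WildQuotientResolution.S1.NodeAtlas
open Summit.ResolutionOfSingularities.ResolutionOfSingularities.Theorems.WildQuotientResolution.S1.BlowupCharts
open Summit.ResolutionOfSingularities.ResolutionOfSingularities.Theorems.WildQuotientResolution.S1.GoodCharts
open Summit.ResolutionOfSingularities.ResolutionOfSingularities.Theorems.WildQuotientResolution.S1.KillableTransport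
open Summit.ResolutionOfSingularities.ResolutionOfSingularities.Theorems.WildQuotientResolution.S1.ChartStable
open Summit.ResolutionOfSingularities.ResolutionOfSingularities.Theorems.WildQuotientResolution.S1.PrincipalChartShrink
open Summit.ResolutionOfSingularities.ResolutionOfSingularities.Theorems.WildQuotientResolution.S1.G1Proof
open Summit.ResolutionOfSingularities.ResolutionOfSingularities.Theorems.WildQuotientResolution.S1.ExtendRees

namespace Summit.ResolutionOfSingularities.ResolutionOfSingularities.Theorems.WildQuotientResolution.S1

/-! ## Bookkeeping -/

namespace KillableReverse

section General

variable {X Y : Scheme.{u}}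

/-- An open immersion restricted to an open inside its range is an isomorphism. -/
theorem isIso_morphismRestrict_of_le (f : X ⟶ Y) [IsOpenImmersion f] (U : Y.Opens) (hU : U ≤ f.opensRange) : IsIso (f ∣_ U) := by
  refine isIso_of_isOpenImmersion_of_opensRange_eq_top _ ?_
  ext x
  simp only [Scheme.Hom.coe_opensRange, Set.mem_range, TopologicalSpace.Opens.coe_top, Set.mem_univ, iff_true]
  obtain ⟨y, hy⟩ := hU x.2
  exact ⟨⟨y, show f.base y ∈ U from hy ▸ x.2⟩, Subtype.ext (by rw [morphismRestrict_base_coe]; exact hy)⟩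

end General

section Actions

variable {V₁ V₂ Y : Scheme.{u}} {q₁ : V₁ ⟶ Y} {q₂ : V₂ ⟶ Y} {G : Type u} [Group G] (ρ₁ : ActionOver q₁ G) (ρ₂ : ActionOver q₂ G)
  (π' : V₂ ⟶ V₁) (hcomm : ∀ g : G, (ρ₂.aut g).hom ≫ π' = π' ≫ (ρ₁.aut g).hom)

include hcomm in
/-- The restriction `π' ∣_ W` of an equivariant map over a stable open is equivariant for the restricted actions. -/
theorem restrict_comm_of_comm (W : V₁.Opens) (hW : ∀ g : G, (ρ₁.aut g).hom ⁻¹ᵁ W = W) (g : G) :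
    ((ρ₂.restrict (π' ⁻¹ᵁ W) (preimage_stable ρ₁ ρ₂ π' hcomm W hW)).aut g).hom ≫ (π' ∣_ W) =
      (π' ∣_ W) ≫ ((ρ₁.restrict W hW).aut g).hom := by
  simp only [← cancel_mono W.ι, Category.assoc, morphismRestrict_ι, morphismRestrict_ι_assoc, ActionOver.restrict_aut_hom,
    ActionOver.restrictHom_ι, ActionOver.restrictHom_ι_assoc, hcomm g]

/-- … and so is its inverse, when `π' ∣_ W` is an isomorphism. -/
theorem restrict_inv_comm_of_comm (W : V₁.Opens) (hW : ∀ g : G, (ρ₁.aut g).hom ⁻¹ᵁ W = W) [IsIso (π' ∣_ W)] (g : G) :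
    ((ρ₁.restrict W hW).aut g).hom ≫ inv (π' ∣_ W) =
      inv (π' ∣_ W) ≫ ((ρ₂.restrict (π' ⁻¹ᵁ W) (preimage_stable ρ₁ ρ₂ π' hcomm W hW)).aut g).hom := by
  rw [IsIso.comp_inv_eq, Category.assoc, restrict_comm_of_comm ρ₁ ρ₂ π' hcomm W hW g, IsIso.inv_hom_id_assoc]

end Actions

end KillableReverse

/-! ## Transfer along an equivariant isomorphism of stable opens of two models -/

namespace GameFrame.GModel

open KillableReverse

variable {p : ℕ} {X' X₁ : Scheme.{0}} {q : X' ⟶ X₁} {G : Type} [Group G] {ρ : G →* Aut X'} {g₀ : G}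

/-- ★ **KILLABILITY TRANSFERS ALONG AN EQUIVARIANT ISOMORPHISM OF STABLE OPENS**: `M₁`, `M₂` models, `W₁`, `W₂` `G`-stable opens, `φ : ↑W₂ ⟶ ↑W₁` an
isomorphism equivariant for the restricted actions and over `X₁`; a principal-centre chart of `M₁` through `W₁.ι (φ x)`, the point lying in the support of
its centre, yields one of `M₂` through `W₂.ι x`. [OURS · L1 W4.5c] -/
theorem killableAt_transfer [Finite G] (M₁ M₂ : GModel p q G ρ g₀) (W₁ : M₁.V.Opens) (hW₁ : ∀ g : G, (M₁.act.aut g).hom ⁻¹ᵁ W₁ = W₁)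
    (W₂ : M₂.V.Opens) (hW₂ : ∀ g : G, (M₂.act.aut g).hom ⁻¹ᵁ W₂ = W₂) (φ : (W₂ : Scheme.{0}) ⟶ (W₁ : Scheme.{0})) [IsIso φ]
    (hφ : ∀ g : G, ((M₂.act.restrict W₂ hW₂).aut g).hom ≫ φ = φ ≫ ((M₁.act.restrict W₁ hW₁).aut g).hom)
    (hφr : W₂.ι ≫ M₂.r = φ ≫ W₁.ι ≫ M₁.r) (x : (W₂ : Scheme.{0}))
    {𝒦 : ReesFiltration M₁.V} {d : ℕ} {O : M₁.act.StableAffineOpens} (hO : IsPrincipalCentreChart p M₁.act g₀ 𝒦 d O) (hd : 0 < d)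
    (hxO : W₁.ι.base (φ.base x) ∈ O.1) (hxs : W₁.ι.base (φ.base x) ∈ ((𝒦.ideal d).support : Set M₁.V)) :
    M₂.KillableAt (W₂.ι.base x) := by
  haveI : IsLocallyNoetherian M₂.V := M₂.isLocallyNoetherian
  -- (1) shrink the chart into `W₁`
  obtain ⟨O₃, hxO₃, -, hO₃W, hO₃aff, hO₃⟩ := exists_isPrincipalCentreChart_le hO hxO hxs W₁ hW₁ (φ.base x).2
  -- (2) restrict to `↑W₁`
  have hcommι₁ : ∀ g : G, ((M₁.act.restrict W₁ hW₁).aut g).hom ≫ W₁.ι = W₁.ι ≫ (M₁.act.aut g).hom := fun g => by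
    rw [ActionOver.restrict_aut_hom, ActionOver.restrictHom_ι]
  have hO₃' : IsAffineOpen (W₁.ι ⁻¹ᵁ O₃.1) := by
    have h : W₁.ι ''ᵁ (W₁.ι ⁻¹ᵁ O₃.1) = O₃.1 := by
      rw [Scheme.Hom.image_preimage_eq_opensRange_inf, Scheme.Opens.opensRange_ι, inf_eq_right.mpr hO₃W]
    rw [← W₁.ι.isAffineOpen_iff_of_isOpenImmersion, h]
    exact hO₃aff
  haveI : IsIso (W₁.ι.appLE O₃.1 (W₁.ι ⁻¹ᵁ O₃.1) le_rfl) := by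
    rw [← Scheme.Hom.app_eq_appLE]
    exact W₁.ι.isIso_app O₃.1 (by rw [Scheme.Opens.opensRange_ι]; exact hO₃W)
  obtain ⟨O₄, hO₄eq, hO₄⟩ := isPrincipalCentreChart_preimage' M₁.act (M₁.act.restrict W₁ hW₁) W₁.ι rfl hcommι₁ g₀ 𝒦 d O₃ hO₃ hO₃'
  -- (3) cross the isomorphism `φ`
  have hO₄' : IsAffineOpen (φ ⁻¹ᵁ O₄.1) := hO₄.1.preimage_of_isIso φ
  haveI : IsIso (φ.appLE O₄.1 (φ ⁻¹ᵁ O₄.1) le_rfl) := isIso_app_of_isIso_morphismRestrict O₄.1 inferInstance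
  obtain ⟨O₅, hO₅eq, hO₅⟩ := isPrincipalCentreChart_preimage' (M₁.act.restrict W₁ hW₁) (M₂.act.restrict W₂ hW₂) φ hφr hφ g₀
    (pullbackRees 𝒦 W₁.ι) d O₄ hO₄ hO₄'
  -- (4) un-restrict along `W₂.ι`
  have hcommι₂ : ∀ g : G, ((M₂.act.restrict W₂ hW₂).aut g).hom ≫ W₂.ι = W₂.ι ≫ (M₂.act.aut g).hom := fun g => by
    rw [ActionOver.restrict_aut_hom, ActionOver.restrictHom_ι]
  obtain ⟨O₆, hO₆eq, hO₆⟩ := isPrincipalCentreChart_image M₂.act (M₂.act.restrict W₂ hW₂) W₂.ι rfl hcommι₂ g₀ _ d O₅ hO₅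
  refine ⟨_, d, O₆, hd, ?_, hO₆⟩
  rw [hO₆eq]
  refine ⟨x, ?_, rfl⟩
  change x ∈ (O₅.1 : Set (W₂ : Scheme.{0}))
  rw [hO₅eq]
  change φ.base x ∈ (O₄.1 : Set (W₁ : Scheme.{0}))
  rw [hO₄eq]
  exact hxO₃

/-- ★ **GOODNESS TRANSFERS ALONG AN EQUIVARIANT ISOMORPHISM OF STABLE OPENS.** [OURS · L1 W4.5c] -/
theorem isGoodAt_transfer [Finite G] (hG : ∀ g : G, g ∈ Subgroup.zpowers g₀) (M₁ M₂ : GModel p q G ρ g₀) (W₁ : M₁.V.Opens)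
    (hW₁ : ∀ g : G, (M₁.act.aut g).hom ⁻¹ᵁ W₁ = W₁) (W₂ : M₂.V.Opens) (hW₂ : ∀ g : G, (M₂.act.aut g).hom ⁻¹ᵁ W₂ = W₂)
    (φ : (W₂ : Scheme.{0}) ⟶ (W₁ : Scheme.{0})) [IsIso φ]
    (hφ : ∀ g : G, ((M₂.act.restrict W₂ hW₂).aut g).hom ≫ φ = φ ≫ ((M₁.act.restrict W₁ hW₁).aut g).hom)
    (hφr : W₂.ι ≫ M₂.r = φ ≫ W₁.ι ≫ M₁.r) (x : (W₂ : Scheme.{0})) (hgood : M₁.IsGoodAt (W₁.ι.base (φ.base x))) :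
    M₂.IsGoodAt (W₂.ι.base x) := by
  -- a good chart inside `W₁`
  obtain ⟨O₁, hxO₁, hO₁W, hO₁, htame⟩ := M₁.exists_good_le hG hgood W₁ hW₁ (φ.base x).2
  -- the transported open
  let ψ : (W₂ : Scheme.{0}) ⟶ M₁.V := φ ≫ W₁.ι
  have hψcomm : ∀ g : G, ((M₂.act.restrict W₂ hW₂).aut g).hom ≫ ψ = ψ ≫ (M₁.act.aut g).hom := fun g => by
    rw [← Category.assoc, hφ g, Category.assoc, ActionOver.restrict_aut_hom _ W₁, ActionOver.restrictHom_ι, Category.assoc]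
  let X₀ : (W₂ : Scheme.{0}).Opens := ψ ⁻¹ᵁ O₁.1
  have hX₀ : ∀ g : G, ((M₂.act.restrict W₂ hW₂).aut g).hom ⁻¹ᵁ X₀ = X₀ := preimage_stable M₁.act (M₂.act.restrict W₂ hW₂) ψ hψcomm O₁.1 O₁.2.1
  have hcommι₂ : ∀ g : G, ((M₂.act.restrict W₂ hW₂).aut g).hom ≫ W₂.ι = W₂.ι ≫ (M₂.act.aut g).hom := fun g => by
    rw [ActionOver.restrict_aut_hom, ActionOver.restrictHom_ι]
  have hstab : ∀ g : G, (M₂.act.aut g).hom ⁻¹ᵁ (W₂.ι ''ᵁ X₀) = W₂.ι ''ᵁ X₀ := image_stable M₂.act (M₂.act.restrict W₂ hW₂) W₂.ι hcommι₂ X₀ hX₀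
  -- `ψ ∣_ O₁` is an isomorphism (open immersion onto `O₁ ⊆ W₁`)
  haveI hψiso : IsIso (ψ ∣_ O₁.1) := by
    refine isIso_morphismRestrict_of_le ψ O₁.1 fun y hy => ?_
    refine ⟨(inv φ).base ⟨y, hO₁W hy⟩, ?_⟩
    change (inv φ ≫ φ ≫ W₁.ι).base ⟨y, hO₁W hy⟩ = y
    rw [IsIso.inv_hom_id_assoc]
    rfl
  haveI hP : IsIso (ψ.appLE O₁.1 X₀ le_rfl) := isIso_app_of_isIso_morphismRestrict O₁.1 hψiso
  -- the chart `W₂.ι '' X₀` of `M₂`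
  have hX₀aff : IsAffineOpen X₀ := by
    haveI : IsAffine (O₁.1 : Scheme.{0}) := hO₁
    exact IsAffine.of_isIso (ψ ∣_ O₁.1)
  have hOaff : IsAffineOpen (W₂.ι ''ᵁ X₀) := hX₀aff.image_of_isOpenImmersion W₂.ι
  haveI : IsAffineHom ((W₂.ι ''ᵁ X₀).ι ≫ M₂.r) := by
    rw [← Scheme.Hom.isoImage_inv_ι W₂.ι X₀, Category.assoc, Category.assoc, hφr, ← Category.assoc φ, ← morphismRestrict_ι_assoc]
    haveI := O₁.2.2
    infer_instance
  let O : M₂.act.StableAffineOpens := ⟨W₂.ι ''ᵁ X₀, hstab, inferInstance⟩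
  -- sections: Γ(M₂.V, W₂.ι '' X₀) ≅ Γ(↑W₂, X₀) ≅ Γ(M₁.V, O₁)
  obtain ⟨P₁, hP₁⟩ : ∃ P₁ : Γ(M₂.V, W₂.ι ''ᵁ X₀) ≃+* Γ((W₂ : Scheme.{0}), X₀), ∀ s, P₁ s = (W₂.ι.appIso X₀).hom s :=
    ⟨(W₂.ι.appIso X₀).commRingCatIsoToRingEquiv, fun _ => rfl⟩
  have hP₁le : ∀ s, P₁ s = W₂.ι.appLE (W₂.ι ''ᵁ X₀) X₀ (W₂.ι.preimage_image_eq X₀).ge s := fun s => by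
    rw [hP₁, Scheme.Hom.appIso_hom']
  obtain ⟨P₂, hP₂⟩ : ∃ P₂ : Γ(M₁.V, O₁.1) ≃+* Γ((W₂ : Scheme.{0}), X₀), ∀ s, P₂ s = ψ.appLE O₁.1 X₀ le_rfl s :=
    ⟨(asIso (ψ.appLE O₁.1 X₀ le_rfl)).commRingCatIsoToRingEquiv, fun _ => rfl⟩
  refine M₂.isGoodAt_of_nodeChart_invariants hG (W₂.ι.base x) O ⟨x, hxO₁, rfl⟩ hOaff (P₁.trans P₂.symm) (actO M₁.act O₁ g₀) (fun t => ?_) htame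
  -- intertwining
  have h1 : P₁ ((M₂.act.aut g₀⁻¹).hom.appLE (W₂.ι ''ᵁ X₀) (W₂.ι ''ᵁ X₀) (hstab g₀⁻¹).ge t) =
      ((M₂.act.restrict W₂ hW₂).aut g₀⁻¹).hom.appLE X₀ X₀ (hX₀ g₀⁻¹).ge (P₁ t) := by
    rw [hP₁le, hP₁le]
    exact (appLE_comm_of_le M₂.act (M₂.act.restrict W₂ hW₂) hcommι₂ (W₂.ι ''ᵁ X₀) hstab X₀ hX₀ (W₂.ι.preimage_image_eq X₀).ge g₀⁻¹ t).symm
  have h2 : ∀ s : Γ(M₁.V, O₁.1), ((M₂.act.restrict W₂ hW₂).aut g₀⁻¹).hom.appLE X₀ X₀ (hX₀ g₀⁻¹).ge (P₂ s) = P₂ (actO M₁.act O₁ g₀ s) :=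
    fun s => by
    rw [hP₂, hP₂]
    exact appLE_comm_of_le M₁.act (M₂.act.restrict W₂ hW₂) hψcomm O₁.1 O₁.2.1 X₀ hX₀ le_rfl g₀⁻¹ s
  change (P₁.trans P₂.symm) ((M₂.act.aut g₀⁻¹).hom.appLE O.1 O.1 (O.2.1 g₀⁻¹).ge t) = actO M₁.act O₁ g₀ ((P₁.trans P₂.symm) t)
  rw [RingEquiv.trans_apply, RingEquiv.trans_apply, h1]
  obtain ⟨s, hs⟩ : ∃ s, P₂ s = P₁ t := P₂.surjective (P₁ t)
  rw [← hs, h2, P₂.symm_apply_apply, P₂.symm_apply_apply]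

/-! ## Down a move: across the idle region, from `Mʼ` to `M` -/

/-- ★ **KILLABILITY DESCENDS ACROSS THE IDLE REGION OF A MOVE**: along a move `π' : Mʼ → M` blowing up `𝒦.ideal d` with `G`-stable support complement,
a point `v'` over the idle region that is killable through a chart `(𝒦₂, d₂, O₂)` with `v' ∈ supp (𝒦₂.ideal d₂)` has KILLABLE image `π' v'`.
[OURS · L1 W4.5c] -/
theorem killableAt_base_of_killableAt [Finite G] (M M' : GModel p q G ρ g₀) (𝒦 : ReesFiltration M.V) (d : ℕ)
    (π' : M'.V ⟶ M.V) (hbl : IsBlowup π' (𝒦.ideal d)) (hr : M'.r = π' ≫ M.r)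
    (hcomm : ∀ g : G, (M'.act.aut g).hom ≫ π' = π' ≫ (M.act.aut g).hom)
    (hsuppG : ∀ g : G, (M.act.aut g).hom ⁻¹ᵁ (𝒦.ideal d).support.compl = (𝒦.ideal d).support.compl)
    {v' : M'.V} (hv' : π'.base v' ∉ ((𝒦.ideal d).support : Set M.V))
    {𝒦₂ : ReesFiltration M'.V} {d₂ : ℕ} {O₂ : M'.act.StableAffineOpens} (hO₂ : IsPrincipalCentreChart p M'.act g₀ 𝒦₂ d₂ O₂) (hd₂ : 0 < d₂)
    (hvO₂ : v' ∈ O₂.1) (hvs : v' ∈ ((𝒦₂.ideal d₂).support : Set M'.V)) : M.KillableAt (π'.base v') := by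
  let W : M.V.Opens := (𝒦.ideal d).support.compl
  have hW' : ∀ g : G, (M'.act.aut g).hom ⁻¹ᵁ (π' ⁻¹ᵁ W) = π' ⁻¹ᵁ W := preimage_stable M.act M'.act π' hcomm W hsuppG
  haveI hiso : IsIso (π' ∣_ W) := hbl.isIso_morphismRestrict (U := W) (by
    rw [Set.disjoint_iff]; rintro x ⟨hx, hx'⟩; exact hx hx')
  have hvW : v' ∈ π' ⁻¹ᵁ W := hv'
  let x : (W : Scheme.{0}) := (π' ∣_ W).base ⟨v', hvW⟩
  have hφx : (inv (π' ∣_ W)).base x = ⟨v', hvW⟩ := by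
    change ((π' ∣_ W) ≫ inv (π' ∣_ W)).base ⟨v', hvW⟩ = _
    rw [IsIso.hom_inv_id]
    rfl
  have hx : W.ι.base x = π'.base v' := morphismRestrict_base_coe π' W ⟨v', hvW⟩
  rw [← hx]
  refine killableAt_transfer M' M (π' ⁻¹ᵁ W) hW' W hsuppG (inv (π' ∣_ W)) (restrict_inv_comm_of_comm M.act M'.act π' hcomm W hsuppG)
    (by rw [hr, ← morphismRestrict_ι_assoc, IsIso.inv_hom_id_assoc]) x hO₂ hd₂ (by rw [hφx]; exact hvO₂) (by rw [hφx]; exact hvs)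

/-- **GOODNESS DESCENDS ACROSS THE IDLE REGION OF A MOVE.** [OURS · L1 W4.5c] -/
theorem isGoodAt_base_of_isGoodAt [Finite G] (hG : ∀ g : G, g ∈ Subgroup.zpowers g₀) (M M' : GModel p q G ρ g₀) (𝒦 : ReesFiltration M.V) (d : ℕ)
    (π' : M'.V ⟶ M.V) (hbl : IsBlowup π' (𝒦.ideal d)) (hr : M'.r = π' ≫ M.r)
    (hcomm : ∀ g : G, (M'.act.aut g).hom ≫ π' = π' ≫ (M.act.aut g).hom)
    (hsuppG : ∀ g : G, (M.act.aut g).hom ⁻¹ᵁ (𝒦.ideal d).support.compl = (𝒦.ideal d).support.compl)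
    {v' : M'.V} (hv' : π'.base v' ∉ ((𝒦.ideal d).support : Set M.V)) (hgood : M'.IsGoodAt v') : M.IsGoodAt (π'.base v') := by
  let W : M.V.Opens := (𝒦.ideal d).support.compl
  have hW' : ∀ g : G, (M'.act.aut g).hom ⁻¹ᵁ (π' ⁻¹ᵁ W) = π' ⁻¹ᵁ W := preimage_stable M.act M'.act π' hcomm W hsuppG
  haveI hiso : IsIso (π' ∣_ W) := hbl.isIso_morphismRestrict (U := W) (by
    rw [Set.disjoint_iff]; rintro x ⟨hx, hx'⟩; exact hx hx')
  have hvW : v' ∈ π' ⁻¹ᵁ W := hv'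
  let x : (W : Scheme.{0}) := (π' ∣_ W).base ⟨v', hvW⟩
  have hφx : (inv (π' ∣_ W)).base x = ⟨v', hvW⟩ := by
    change ((π' ∣_ W) ≫ inv (π' ∣_ W)).base ⟨v', hvW⟩ = _
    rw [IsIso.hom_inv_id]
    rfl
  have hx : W.ι.base x = π'.base v' := morphismRestrict_base_coe π' W ⟨v', hvW⟩
  rw [← hx]
  refine isGoodAt_transfer hG M' M (π' ⁻¹ᵁ W) hW' W hsuppG (inv (π' ∣_ W)) (restrict_inv_comm_of_comm M.act M'.act π' hcomm W hsuppG)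
    (by rw [hr, ← morphismRestrict_ι_assoc, IsIso.inv_hom_id_assoc]) x ?_
  rw [hφx]
  exact hgood

/-- ★ **THE NON-KILLABLE POINTS OF `M` OFF THE SUPPORT EMBED INTO `nonKillable Mʼ`** (over a Noetherian base for `Mʼ`, so that G1 supplies the support
hypothesis of the descent). [OURS · L1 W4.5c] -/
theorem exists_isInducing_nonKillable_inter [Finite G] (hp : p.Prime) (hG : ∀ g : G, g ∈ Subgroup.zpowers g₀) (M M' : GModel p q G ρ g₀)
    (hB' : M'.HasNoetherianBase) (𝒦 : ReesFiltration M.V) (d : ℕ) (h𝒦G : ∀ g : G, (𝒦.ideal d).comap (M.act.aut g).hom = 𝒦.ideal d)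
    (π' : M'.V ⟶ M.V) (hbl : IsBlowup π' (𝒦.ideal d)) (hr : M'.r = π' ≫ M.r) (hcomm : ∀ g : G, (M'.act.aut g).hom ≫ π' = π' ≫ (M.act.aut g).hom) :
    ∃ ψ : ↥(M.nonKillable \ ((𝒦.ideal d).support : Set M.V)) → ↥M'.nonKillable, IsInducing ψ := by
  have hsuppG := fun g => preimage_support_compl_of_comap_eq M (I := 𝒦.ideal d) h𝒦G g
  let W : M.V.Opens := (𝒦.ideal d).support.compl
  haveI hiso : IsIso (π' ∣_ W) := hbl.isIso_morphismRestrict (U := W) (by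
    rw [Set.disjoint_iff]; rintro x ⟨hx, hx'⟩; exact hx hx')
  let e : ↥(π' ⁻¹ᵁ W) ≃ₜ ↥W := Scheme.homeoOfIso (asIso (π' ∣_ W))
  -- the candidate map: `v ↦ e⁻¹ v`
  let φ₀ : ↥(M.nonKillable \ ((𝒦.ideal d).support : Set M.V)) → M'.V := fun v => (e.symm ⟨v.1, v.2.2⟩ : ↥(π' ⁻¹ᵁ W)).1
  have hφ₀ : ∀ v, π'.base (φ₀ v) = v.1 := fun v => by
    have h1 : ((e (e.symm ⟨v.1, v.2.2⟩) : ↥W) : M.V) = v.1 := by rw [e.apply_symm_apply]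
    rw [← h1]
    exact (morphismRestrict_base_coe π' W (e.symm ⟨v.1, v.2.2⟩)).symm
  have hind₀ : IsInducing φ₀ := by
    refine IsInducing.subtypeVal.comp (e.symm.isInducing.comp ?_)
    exact (IsInducing.subtypeVal.codRestrict (fun v => v.2.2) :
      IsInducing fun v : ↥(M.nonKillable \ ((𝒦.ideal d).support : Set M.V)) => (⟨v.1, v.2.2⟩ : ↥W))
  have hmem₀ : ∀ v, φ₀ v ∈ M'.nonKillable := fun v => by
    have hvW : π'.base (φ₀ v) ∉ ((𝒦.ideal d).support : Set M.V) := by rw [hφ₀]; exact v.2.2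
    refine ⟨fun hgood => v.2.1.1 ?_, fun ⟨𝒦₂, d₂, O₂, hd₂, hvO₂, hO₂⟩ => v.2.1.2 ?_⟩
    · rw [← hφ₀ v]
      exact isGoodAt_base_of_isGoodAt hG M M' 𝒦 d π' hbl hr hcomm hsuppG hvW hgood
    · have hbad : φ₀ v ∈ M'.badLocus := fun hgood => v.2.1.1 (by
        rw [← hφ₀ v]; exact isGoodAt_base_of_isGoodAt hG M M' 𝒦 d π' hbl hr hcomm hsuppG hvW hgood)
      have hvs : φ₀ v ∈ ((𝒦₂.ideal d₂).support : Set M'.V) := g1 hp q G ρ g₀ hG M' 𝒦₂ d₂ O₂ hB' hO₂ _ hvO₂ hbad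
      rw [← hφ₀ v]
      exact killableAt_base_of_killableAt M M' 𝒦 d π' hbl hr hcomm hsuppG hvW hO₂ hd₂ hvO₂ hvs
  exact ⟨Set.codRestrict φ₀ _ hmem₀, hind₀.codRestrict hmem₀⟩

/-- ★ **THE FORMAL HALF OF (A0)**: along any admissible move, `dim (nonKillable M ∖ supp 𝒦_d) ≤ jInf Mʼ` — a move can lower `jInf` only THROUGH ITS SUPPORT.
[OURS · L1 W4.5c] -/
theorem topologicalKrullDim_nonKillable_diff_support_le_jInf [Finite G] (hp : p.Prime) (hG : ∀ g : G, g ∈ Subgroup.zpowers g₀)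
    (M M' : GModel p q G ρ g₀) (hB' : M'.HasNoetherianBase) (𝒦 : ReesFiltration M.V) (d : ℕ)
    (h𝒦G : ∀ g : G, (𝒦.ideal d).comap (M.act.aut g).hom = 𝒦.ideal d) (hmv : M.IsMoveOf M' 𝒦 d) :
    topologicalKrullDim ↥(M.nonKillable \ ((𝒦.ideal d).support : Set M.V)) ≤ M'.jInf := by
  obtain ⟨π', hbl, -, hr, hcomm⟩ := hmv
  obtain ⟨ψ, hψ⟩ := exists_isInducing_nonKillable_inter hp hG M M' hB' 𝒦 d h𝒦G π' hbl hr hcomm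
  exact hψ.topologicalKrullDim_le

end GameFrame.GModel

end Summit.ResolutionOfSingularities.ResolutionOfSingularities.Theorems.WildQuotientResolution.S1

end
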